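import Summits.CriticalPhenomena.SAWScalingLimit.Theorems.SAWWeldingIdentificationEventualTightNoSubmeshFjord
import Summits.CriticalPhenomena.SAWScalingLimit.Theorems.SAWWeldingIdentificationEventualTightOfNoReturn
import HarnessLib

/-!
# `NoReturnTight → EventualTight` and `NoFjordAllScales → EventualTight` (crux stmt-CriticalPhenomena-1372, lead c9)

Rungs INTO the crux `SAWWeldingIdentification.EventualTight` (line `Sketch`, bet route `SAWWeldingIdentification`) from
the no-return strengthenings typed by the crux-strategists (`Cruxes/EventualTight/StrategistSketch_{b1,s3,s3B}.lean`,
`STRATEGY-CENSUS.md` §Strengthen), completing in the tree the chain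

    NoFjordAllScales (s3 S1: no fjords at all scales = uniform Hölder banks, the welding route's `RemovableLimit` engine)
      → NoReturnTight (b1 S_A: thresholds ε, δ₀ depending on (ℓ, θ))
      → NoReturnTightU (one δ₀; `noReturnTightU_of_noReturnTight`, via the emptiness of sub-mesh fjords,
                        `Theorems.sawPolyline_noSubmeshFjord`)
      → EventualTight (landed `Theorems.eventualTight_of_noReturnTightU`, p158440: AB99 Lemma 4.1 + fjord pigeonhole).

Registered stubs proved here: `eventualTight_of_noReturnTight`, `eventualTight_of_noFjordAllScales` (hypotheses
inlined; nothing is asserted — both hypotheses are STRENGTHENINGS of the research-open crux, recorded so that a route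
owning a no-return / Hölder-banks crux closes its `EventualTight` by name).  `noReturnTight_of_noFjordAllScales` is
strategist s3's proof, transcribed with the fjord event inlined.
-/

noncomputable section

open Set Metric
open Literature.Probability.LatticeModels Literature.Probability.RandomPlanarGeometry

namespace Summit.CriticalPhenomena.SAWScalingLimit.Theorems

section Rungs

open MeasureTheory Literature.Probability.RandomPlanarGeometry

/-- **`NoReturnTight → NoReturnTightU`.**  The fixed-scale no-return strengthening of strategist b1 / s3
(`Cruxes/EventualTight/StrategistSketch_s3.lean`: thresholds `ε, δ₀` depending on `(ℓ, θ)`) implies the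
uniform-threshold form consumed by `eventualTight_of_noReturnTightU` (one `δ₀` for all `(ℓ, θ)`; here `δ₀ = 1`):
for meshes above the scale-dependent threshold the `(ε', ℓ)`-return event with `ε' < min (δ₁, ℓ)` is empty
(`NoSubmeshFjord.not_exists_fjord_of_lt_mesh`), below it the hypothesis applies. [folklore] -/
theorem noReturnTightU_of_noReturnTight
    (h : ∀ (D : DobrushinDomain) (a b : ℝ → Site 2), SAW.IsEndpointApprox D a b →
      ∀ ℓ : ℝ, 0 < ℓ → ∀ θ : ℝ, 0 < θ → ∃ (ε δ₀ : ℝ), 0 < ε ∧ 0 < δ₀ ∧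
        ∀ δ ∈ Set.Ioc (0 : ℝ) δ₀, SAW.law D.carrier δ (a δ) (b δ)
          {γ | ∃ s t u : unitInterval, s < t ∧ t < u ∧
              dist ((⟨γ.walk.toCurve (meshPoint δ)⟩ : Curve ℂ) s) ((⟨γ.walk.toCurve (meshPoint δ)⟩ : Curve ℂ) u) ≤ ε ∧
              ℓ ≤ dist ((⟨γ.walk.toCurve (meshPoint δ)⟩ : Curve ℂ) s) ((⟨γ.walk.toCurve (meshPoint δ)⟩ : Curve ℂ) t)} ≤
          ENNReal.ofReal θ)
    (D : DobrushinDomain) (a b : ℝ → Site 2) (hab : SAW.IsEndpointApprox D a b) :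
    ∃ δ₀ : ℝ, 0 < δ₀ ∧ ∀ ℓ : ℝ, 0 < ℓ → ∀ θ : ℝ, 0 < θ → ∃ ε : ℝ, 0 < ε ∧
      ∀ δ ∈ Set.Ioc (0 : ℝ) δ₀, SAW.law D.carrier δ (a δ) (b δ)
        {γ | ∃ s t u : unitInterval, s < t ∧ t < u ∧
            dist ((⟨γ.walk.toCurve (meshPoint δ)⟩ : Curve ℂ) s) ((⟨γ.walk.toCurve (meshPoint δ)⟩ : Curve ℂ) u) ≤ ε ∧
            ℓ ≤ dist ((⟨γ.walk.toCurve (meshPoint δ)⟩ : Curve ℂ) s) ((⟨γ.walk.toCurve (meshPoint δ)⟩ : Curve ℂ) t)} ≤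
        ENNReal.ofReal θ := by
  refine ⟨1, one_pos, fun ℓ hℓ θ hθ => ?_⟩
  obtain ⟨ε, δ₁, hε, hδ₁, hbound⟩ := h D a b hab ℓ hℓ θ hθ
  set m : ℝ := min ε (min δ₁ ℓ) with hm
  have hmpos : 0 < m := lt_min hε (lt_min hδ₁ hℓ)
  have hmε : m ≤ ε := min_le_left _ _
  have hmδ₁ : m ≤ δ₁ := (min_le_right _ _).trans (min_le_left _ _)
  have hmℓ : m ≤ ℓ := (min_le_right _ _).trans (min_le_right _ _)
  refine ⟨m / 2, half_pos hmpos, fun δ hδ => ?_⟩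
  by_cases hδδ₁ : δ ≤ δ₁
  · -- small meshes: the hypothesis, by monotonicity in the closeness parameter
    refine le_trans (measure_mono ?_) (hbound δ ⟨hδ.1, hδδ₁⟩)
    rintro γ ⟨s, t, u, hst, htu, hsu, hfar⟩
    exact ⟨s, t, u, hst, htu, hsu.trans (by linarith), hfar⟩
  · -- meshes above `δ₁`: the event is empty
    have hempty : {γ : SAW.DomainSAW D.carrier δ (a δ) (b δ) | ∃ s t u : unitInterval, s < t ∧ t < u ∧
        dist ((⟨γ.walk.toCurve (meshPoint δ)⟩ : Curve ℂ) s) ((⟨γ.walk.toCurve (meshPoint δ)⟩ : Curve ℂ) u) ≤ m / 2 ∧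
        ℓ ≤ dist ((⟨γ.walk.toCurve (meshPoint δ)⟩ : Curve ℂ) s) ((⟨γ.walk.toCurve (meshPoint δ)⟩ : Curve ℂ) t)} = ∅ := by
      ext γ
      simp only [Set.mem_setOf_eq, Set.mem_empty_iff_false, iff_false]
      exact sawPolyline_noSubmeshFjord hδ.1 γ (by linarith [not_le.1 hδδ₁]) (by linarith)
    rw [hempty, measure_empty]
    exact bot_le

/-- **`NoReturnTight → EventualTight`** (this route's decl, by name): the scale-dependent no-return strengthening
of eventual tightness (strategist b1 `S_A`, s3 `NoReturnTight`) closes the crux — `noReturnTightU_of_noReturnTight`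
and the landed `eventualTight_of_noReturnTightU` (AB99 Lemma 4.1 through the fjord pigeonhole).
[cite: AizenmanBurchardDuke1999, Lemma 4.1] -/
theorem eventualTight_of_noReturnTight :
    (∀ (D : DobrushinDomain) (a b : ℝ → Site 2), SAW.IsEndpointApprox D a b →
      ∀ ℓ : ℝ, 0 < ℓ → ∀ θ : ℝ, 0 < θ → ∃ (ε δ₀ : ℝ), 0 < ε ∧ 0 < δ₀ ∧
        ∀ δ ∈ Set.Ioc (0 : ℝ) δ₀, SAW.law D.carrier δ (a δ) (b δ)
          {γ | ∃ s t u : unitInterval, s < t ∧ t < u ∧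
              dist ((⟨γ.walk.toCurve (meshPoint δ)⟩ : Curve ℂ) s) ((⟨γ.walk.toCurve (meshPoint δ)⟩ : Curve ℂ) u) ≤ ε ∧
              ℓ ≤ dist ((⟨γ.walk.toCurve (meshPoint δ)⟩ : Curve ℂ) s) ((⟨γ.walk.toCurve (meshPoint δ)⟩ : Curve ℂ) t)} ≤
          ENNReal.ofReal θ) →
    Summit.CriticalPhenomena.SAWScalingLimit.Theses.SAWWeldingIdentification.EventualTight := by
  intro h
  exact eventualTight_of_noReturnTightU (noReturnTightU_of_noReturnTight h)

/-- **`NoFjordAllScales → NoReturnTight`** (strategist s3, `Cruxes/EventualTight/StrategistSketch_s3.lean`, with the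
fjord event inlined): at the single scale `w = ε` with `M ε^λ ≤ ℓ`, an `(ε, ℓ)`-return IS an `(ε, M ε^λ)`-fjord.
[folklore] -/
theorem noReturnTight_of_noFjordAllScales
    (h : ∀ (D : DobrushinDomain) (a b : ℝ → Site 2), SAW.IsEndpointApprox D a b →
      ∃ lam : ℝ, 0 < lam ∧ lam < 1 ∧ ∀ θ : ℝ, 0 < θ → ∃ (M w₀ δ₀ : ℝ), 0 < M ∧ 0 < w₀ ∧ 0 < δ₀ ∧
        ∀ δ ∈ Set.Ioc (0 : ℝ) δ₀, SAW.law D.carrier δ (a δ) (b δ)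
          {γ | ∃ w : ℝ, δ ≤ w ∧ w ≤ w₀ ∧ ∃ s t u : unitInterval, s < t ∧ t < u ∧
              dist ((⟨γ.walk.toCurve (meshPoint δ)⟩ : Curve ℂ) s) ((⟨γ.walk.toCurve (meshPoint δ)⟩ : Curve ℂ) u) ≤ w ∧
              M * w ^ lam ≤
                dist ((⟨γ.walk.toCurve (meshPoint δ)⟩ : Curve ℂ) s) ((⟨γ.walk.toCurve (meshPoint δ)⟩ : Curve ℂ) t)} ≤
          ENNReal.ofReal θ)
    (D : DobrushinDomain) (a b : ℝ → Site 2) (hab : SAW.IsEndpointApprox D a b) (ℓ : ℝ) (hℓ : 0 < ℓ) (θ : ℝ)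
    (hθ : 0 < θ) :
    ∃ (ε δ₀ : ℝ), 0 < ε ∧ 0 < δ₀ ∧ ∀ δ ∈ Set.Ioc (0 : ℝ) δ₀, SAW.law D.carrier δ (a δ) (b δ)
      {γ | ∃ s t u : unitInterval, s < t ∧ t < u ∧
          dist ((⟨γ.walk.toCurve (meshPoint δ)⟩ : Curve ℂ) s) ((⟨γ.walk.toCurve (meshPoint δ)⟩ : Curve ℂ) u) ≤ ε ∧
          ℓ ≤ dist ((⟨γ.walk.toCurve (meshPoint δ)⟩ : Curve ℂ) s) ((⟨γ.walk.toCurve (meshPoint δ)⟩ : Curve ℂ) t)} ≤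
      ENNReal.ofReal θ := by
  obtain ⟨lam, hlam0, _hlam1, hθall⟩ := h D a b hab
  obtain ⟨M, w₀, δ₀, hM, hw₀, hδ₀, hbound⟩ := hθall θ hθ
  set ε : ℝ := min w₀ ((ℓ / M) ^ (1 / lam)) with hε
  have hεpos : 0 < ε := lt_min hw₀ (Real.rpow_pos_of_pos (div_pos hℓ hM) _)
  have hεw : ε ≤ w₀ := min_le_left _ _
  have hεℓ : M * ε ^ lam ≤ ℓ := by
    have h1 : ε ^ lam ≤ ((ℓ / M) ^ (1 / lam)) ^ lam :=
      Real.rpow_le_rpow hεpos.le (min_le_right _ _) hlam0.le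
    have h2 : ((ℓ / M) ^ (1 / lam)) ^ lam = ℓ / M := by
      rw [← Real.rpow_mul (div_pos hℓ hM).le, one_div, inv_mul_cancel₀ hlam0.ne', Real.rpow_one]
    rw [h2] at h1
    calc M * ε ^ lam ≤ M * (ℓ / M) := mul_le_mul_of_nonneg_left h1 hM.le
      _ = ℓ := by field_simp
  refine ⟨ε, min ε δ₀, hεpos, lt_min hεpos hδ₀, fun δ hδ => ?_⟩
  have hδ' : δ ∈ Set.Ioc (0 : ℝ) δ₀ := ⟨hδ.1, hδ.2.trans (min_le_right _ _)⟩
  refine le_trans (measure_mono ?_) (hbound δ hδ')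
  intro γ hγ
  obtain ⟨s, t, u, hst, htu, hsu, hfar⟩ := hγ
  exact ⟨ε, hδ.2.trans (min_le_left _ _), hεw, s, t, u, hst, htu, hsu, hεℓ.trans hfar⟩

/-- **`NoFjordAllScales → EventualTight`** (this route's decl, by name): the welding-natural strengthening — a
polynomial no-fjord bound at all scales, the lattice form of "both banks of the walk are uniformly Hölder domains",
i.e. the engine the route's crux `RemovableLimit` names — closes the tightness crux
(`noReturnTight_of_noFjordAllScales`, `eventualTight_of_noReturnTight`). [cite: AizenmanBurchardDuke1999, Lemma 4.1] -/
theorem eventualTight_of_noFjordAllScales :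
    (∀ (D : DobrushinDomain) (a b : ℝ → Site 2), SAW.IsEndpointApprox D a b →
      ∃ lam : ℝ, 0 < lam ∧ lam < 1 ∧ ∀ θ : ℝ, 0 < θ → ∃ (M w₀ δ₀ : ℝ), 0 < M ∧ 0 < w₀ ∧ 0 < δ₀ ∧
        ∀ δ ∈ Set.Ioc (0 : ℝ) δ₀, SAW.law D.carrier δ (a δ) (b δ)
          {γ | ∃ w : ℝ, δ ≤ w ∧ w ≤ w₀ ∧ ∃ s t u : unitInterval, s < t ∧ t < u ∧
              dist ((⟨γ.walk.toCurve (meshPoint δ)⟩ : Curve ℂ) s) ((⟨γ.walk.toCurve (meshPoint δ)⟩ : Curve ℂ) u) ≤ w ∧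
              M * w ^ lam ≤
                dist ((⟨γ.walk.toCurve (meshPoint δ)⟩ : Curve ℂ) s) ((⟨γ.walk.toCurve (meshPoint δ)⟩ : Curve ℂ) t)} ≤
          ENNReal.ofReal θ) →
    Summit.CriticalPhenomena.SAWScalingLimit.Theses.SAWWeldingIdentification.EventualTight := by
  intro h
  exact eventualTight_of_noReturnTight (noReturnTight_of_noFjordAllScales h)

end Rungs

end Summit.CriticalPhenomena.SAWScalingLimit.Theorems

end
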